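import Summits.BirchSwinnertonDyer.BirchSwinnertonDyer.Theorems.ManinLocalTwoThreeManinPrimeToThreeAtNineTwistOrbitMinimal
import Summits.BirchSwinnertonDyer.BirchSwinnertonDyer.Theorems.ManinLocalTwoThreeManinOddAtFourDiscLevelMinimal
import HarnessLib

/-!
# Route `ManinLocalTwoThree` (cell `bsd-f2-manin`): crux C3 `ManinPrimeToThreeAtNine` (stmt-BirchSwinnertonDyer-22968)
# REDUCED to the (odd level, 2-additivity, |Δ_min|, level, sign)-MINIMAL classes — twin normal form at `3` and
# aligned `χ±8` partners at ANY 2-level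

Strengthening of `maninLocalTwoThree_maninPrimeToThreeAtNine_of_twistOrbitMinimal` (seat p2, gen 2; residue 92 797)
by two prime-generic transports along the dyadic twist web of a class additive at `3` AND at `2`:
* (vii) the `χ₋₄`-TWIN NORMAL FORM at `3` (port of C2's clause (vi), `…ManinOddAtFourTwinNormalForm`): on a
  same-level twin pair `{W, W ⊗ ℚ(√−1)}` (`2⁴ ∣ N`, Connell–Pal `Δ' = Δ`) the exact divisibility
  `c(D_W) ∣ c(D_A)` (`maninLocalTwoThree_maninConstant_dvd_of_additiveTwist_negOne`) transports `3 ∤ c` as well,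
  so the hypothesis is needed for the twin with `c₆ ≥ 0` only;
* (v) aligned `χ±8` partners at ANY `2`-level (`N(A) ∣ 2⁶N`), by the level-free engine of
  `ManinLocalTwoThreeLevelFreeTwistTransport` (this seat, gen 3), with (iv)/(v) re-cut by `|Δ_min|` as in
  `…ManinOddAtFourDiscLevelMinimal`.
Induction on (`2·ordCompl[2] N + [4 ∣ N]`, `|Δ_min|`, `2N + [c₆ < 0]`): the odd semistable untwist (ii) lowers the
odd part of the level, the dyadic semistable untwist (iii) removes the additivity at `2`, everything else keeps
both and lowers (`|Δ_min|`, level, sign).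

CENSUS (cell table TWISTCENSUS2 joined on exact discriminants; this seat's census7.py; optimal classes with
`9 ∣ N ≤ 5·10⁵`, all `c = 1` by Cremona): residue **89 125** = `W[3]`-irreducible 81 600 + reducible 7 525
(`v₃(N)` 2: 31 172 · 3: 39 526 · 4: 12 434 · 5: 5 993), against the landed 92 797 (intersection 89 058, union
92 864; the twin normal form alone gives 89 588; the 67 classes that enter were eliminated only by a lower-level
aligned `χ±8`-partner of larger `|Δ|`). OPEN on the residue; nothing here proves BSD or Manin's conjecture.
Seat bsd-line-manin23-p2 (gen 3).

References: [Stevens1989] Lemmas (5.2), (5.4); [Cesnavicius2018] Thm. 1.2; [Pal2012] Prop. 2.4, Lemma 3.1.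
-/

set_option autoImplicit false
set_option linter.dupNamespace false

noncomputable section

open scoped MatrixGroups ModularForm Classical NumberField

namespace Summit.BirchSwinnertonDyer.BirchSwinnertonDyer.Theorems

open CongruenceSubgroup WeierstrassCurve IsDedekindDomain IsDedekindDomain.HeightOneSpectrum
  Rat.HeightOneSpectrum Literature.NumberTheory.Automorphic
  Literature.NumberTheory.EllipticCurves Literature.NumberTheory.EllipticCurves.ModularForms
  Summit.BirchSwinnertonDyer.Rank1Residual.ManinAdditive

/-- **Crux C3 `ManinPrimeToThreeAtNine` ⟸ Manin's conjecture at `3` on the optimal classes that are MINIMAL for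
(odd part of the conductor, additivity at `2`, `|Δ_min|`, conductor, `[c₆ < 0]`) among their aligned twist
partners** (one hypothesis, kernel-checked composition). Modulo the four printed facts it suffices to prove
`3 ∤ c` for the lattice-optimal data `D` with `9 ∣ N` whose class admits (i) no `χ₋₃`-untwist to a class
semistable at `3`; (ii) no odd semistable untwist `χ_{q*}` (`q ≠ 2, 3`); (iii) no dyadic untwist to a class
semistable at `2` (`4 ∣ N`); (iv) no `χ₋₄`-untwist to a lattice-optimal ADDITIVE-at-`2` `A` of LOWER conductor
`N(A) ∣ N` with `|Δ_min(A)| ≤ |Δ_min(W)|` (`2⁴ ∣ N`); (v) no ALIGNED `χ±8`-untwist to a lattice-optimal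
additive-at-`2` `A` at ANY `2`-level `N(A) ∣ 2⁶N` (`4 ∣ N`; `Δ(C) = d⁶Δ(A)` for the minimal model `C ∼ W` of
`A ⊗ ℚ(√±2)`) with `|Δ_min(A)| < |Δ_min(W)|`, or `N(A) < N` and `≤` — level-free engine
`maninLocalTwoThree_maninConstant_dvd_of_additiveTwist_two_aligned_levelFree`; (vi) no aligned same-level
`χ_{q*}`-untwist (`q` odd, `q = 3` allowed) with smaller `|Δ_min|`; (vii) (NEW at `3`) the `χ₋₄`-TWIN NORMAL
FORM: not (`c₆(W) < 0` and a lattice-optimal same-level twin `A`, `W ∼ A ⊗ ℚ(√−1)`, `2⁴ ∣ N`, additive at `2`,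
`|Δ_min(A)| ≤ |Δ_min(W)|`, `c₆(A) > 0`) — the exact same-level `χ₋₄` divisibility `c(D_W) ∣ c(D_A)` is
prime-generic. Induction on (`2·ordCompl[2] N + [4 ∣ N]`, `|Δ_min|`, `2N + [c₆ < 0]`): (ii) lowers the odd part
of the level, (iii) keeps it and removes the additivity at `2`, every other clause keeps both and lowers
(`|Δ_min|`, level, sign). CENSUS (cell table TWISTCENSUS2, this seat's join census7.py; optimal classes with
`9 ∣ N ≤ 5·10⁵`): residue **89 125** = irreducible 81 600 + reducible 7 525 (`v₃(N)`: 2: 31 172 · 3: 39 526 ·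
4: 12 434 · 5: 5 993) against 92 797 for the landed twist-orbit-minimal reduction (twin normal form alone:
89 588). OPEN on that residue; nothing here proves BSD or Manin's conjecture.
[cite: Stevens1989, Lemmas (5.2), (5.4)] [cite: Cesnavicius2018, Thm. 1.2] [cite: Pal2012, Prop. 2.4, Lemma 3.1] -/
theorem maninLocalTwoThree_maninPrimeToThreeAtNine_of_discLevelMinimal
    (H : Literature.NumberTheory.EllipticCurves.ModularForms.mazur_not_dvd_maninConstant_of_odd →
      Literature.NumberTheory.EllipticCurves.ModularForms.abbesUllmo_not_dvd_maninConstant_of_not_dvd_level →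
      Literature.NumberTheory.EllipticCurves.ModularForms.cesnavicius_not_two_dvd_maninConstant_of_two_dvd_level →
      Literature.NumberTheory.EllipticCurves.ModularForms.exists_isNewformOf →
      ∀ (W : WeierstrassCurve ℚ) [W.IsElliptic] [W.IsGloballyMinimal] {N : ℕ} [NeZero N]
        (D : ModularParametrizationData W N),
        (∀ z ∈ D.L.lattice, ∃ w ∈ periodLattice D.f, z = D.c * w) → 3 ^ 2 ∣ N →
        ¬ (∃ (W' : WeierstrassCurve ℚ) (d : ℤ), W'.IsElliptic ∧ W'.IsGloballyMinimal ∧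
          (d = -3) ∧ IsIsogenous W (W'.quadraticTwist (d : ℚ)) ∧
          ¬ 3 ^ 2 ∣ W'.conductorNorm ℤ) →
        ¬ (∃ (W' : WeierstrassCurve ℚ) (q : ℕ), W'.IsElliptic ∧ W'.IsGloballyMinimal ∧
          q.Prime ∧ q ≠ 2 ∧ q ≠ 3 ∧ q ^ 2 ∣ N ∧
          IsIsogenous W (W'.quadraticTwist (((-1 : ℤ) ^ (q / 2) * q : ℤ) : ℚ)) ∧
          ¬ q ^ 2 ∣ W'.conductorNorm ℤ) →
        ¬ (∃ (W' : WeierstrassCurve ℚ) (d : ℤ), W'.IsElliptic ∧ W'.IsGloballyMinimal ∧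
          (d = -1 ∨ d = 2 ∨ d = -2) ∧ 2 ^ 2 ∣ N ∧ IsIsogenous W (W'.quadraticTwist (d : ℚ)) ∧
          ¬ 2 ^ 2 ∣ W'.conductorNorm ℤ) →
        ¬ (∃ (A : WeierstrassCurve ℚ) (_ : A.IsElliptic) (_ : A.IsGloballyMinimal) (N' : ℕ) (_ : NeZero N')
          (D' : ModularParametrizationData A N'),
          (∀ z ∈ D'.L.lattice, ∃ w ∈ periodLattice D'.f, z = D'.c * w) ∧ 2 ^ 4 ∣ N ∧
          2 ^ 2 ∣ A.conductorNorm ℤ ∧ A.conductorNorm ℤ ∣ N ∧ A.conductorNorm ℤ < N ∧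
          IsIsogenous W (A.quadraticTwist ((-1 : ℤ) : ℚ)) ∧
          A.minimalDiscriminantInt.natAbs ≤ W.minimalDiscriminantInt.natAbs) →
        ¬ (∃ (A : WeierstrassCurve ℚ) (_ : A.IsElliptic) (_ : A.IsGloballyMinimal) (N' : ℕ) (_ : NeZero N')
          (D' : ModularParametrizationData A N') (d : ℤ) (C : WeierstrassCurve ℚ) (u : VariableChange ℚ),
          C.IsElliptic ∧ C.IsGloballyMinimal ∧
          (∀ z ∈ D'.L.lattice, ∃ w ∈ periodLattice D'.f, z = D'.c * w) ∧ (d = 2 ∨ d = -2) ∧ 2 ^ 2 ∣ N ∧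
          2 ^ 2 ∣ A.conductorNorm ℤ ∧ A.conductorNorm ℤ ∣ 2 ^ 6 * N ∧
          IsIsogenous W (A.quadraticTwist (d : ℚ)) ∧ u • A.quadraticTwist (d : ℚ) = C ∧
          C.Δ = (d : ℚ) ^ 6 * A.Δ ∧
          (A.minimalDiscriminantInt.natAbs < W.minimalDiscriminantInt.natAbs ∨
            (A.conductorNorm ℤ < N ∧ A.minimalDiscriminantInt.natAbs ≤ W.minimalDiscriminantInt.natAbs))) →
        ¬ (∃ (A : WeierstrassCurve ℚ) (_ : A.IsElliptic) (_ : A.IsGloballyMinimal)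
          (D' : ModularParametrizationData A N) (q : ℕ) (C : WeierstrassCurve ℚ) (u : VariableChange ℚ),
          C.IsElliptic ∧ C.IsGloballyMinimal ∧
          (∀ z ∈ D'.L.lattice, ∃ w ∈ periodLattice D'.f, z = D'.c * w) ∧ q.Prime ∧ q ≠ 2 ∧ q ^ 2 ∣ N ∧
          IsIsogenous C W ∧ u • A.quadraticTwist (((-1 : ℤ) ^ (q / 2) * q : ℤ) : ℚ) = C ∧
          C.Δ = ((((-1 : ℤ) ^ (q / 2) * q : ℤ)) : ℚ) ^ 6 * A.Δ ∧
          A.minimalDiscriminantInt.natAbs < W.minimalDiscriminantInt.natAbs) →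
        ¬ (W.c₆ < 0 ∧ ∃ (A : WeierstrassCurve ℚ) (_ : A.IsElliptic) (_ : A.IsGloballyMinimal)
          (D' : ModularParametrizationData A N),
          (∀ z ∈ D'.L.lattice, ∃ w ∈ periodLattice D'.f, z = D'.c * w) ∧ 2 ^ 4 ∣ N ∧
          2 ^ 2 ∣ A.conductorNorm ℤ ∧ IsIsogenous W (A.quadraticTwist ((-1 : ℤ) : ℚ)) ∧
          A.minimalDiscriminantInt.natAbs ≤ W.minimalDiscriminantInt.natAbs ∧ 0 < A.c₆) →
        ¬ (3 : ℤ) ∣ D.maninConstant) :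
    Summit.BirchSwinnertonDyer.BirchSwinnertonDyer.Theses.ManinLocalTwoThree.ManinPrimeToThreeAtNine := by
  intro hM hAU hC2 hnf
  -- measure: (`2·ordCompl[2] N + [4 ∣ N]`, `|Δ_min W|`, `2N + [c₆(W) < 0]`), lexicographic
  suffices key : ∀ (o m n : ℕ) (W : WeierstrassCurve ℚ) [W.IsElliptic] [W.IsGloballyMinimal] (N : ℕ)
      [NeZero N] (D : ModularParametrizationData W N),
      2 * ordCompl[2] N + (if 2 ^ 2 ∣ N then 1 else 0) < o →
      W.minimalDiscriminantInt.natAbs < m → 2 * N + (if W.c₆ < 0 then 1 else 0) < n →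
      (∀ z ∈ D.L.lattice, ∃ w ∈ periodLattice D.f, z = D.c * w) → 3 ^ 2 ∣ N →
      ¬ (3 : ℤ) ∣ D.maninConstant by
    intro W _ _ N _ D hopt h9
    exact key (2 * ordCompl[2] N + (if 2 ^ 2 ∣ N then 1 else 0) + 1) (W.minimalDiscriminantInt.natAbs + 1)
      (2 * N + (if W.c₆ < 0 then 1 else 0) + 1) W N D (Nat.lt_succ_self _) (Nat.lt_succ_self _)
      (Nat.lt_succ_self _) hopt h9
  have hb : ∀ X : WeierstrassCurve ℚ, (if X.c₆ < 0 then 1 else 0) ≤ 1 := fun X ↦ by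
    split_ifs <;> omega
  have hb4 : ∀ M : ℕ, (if 2 ^ 2 ∣ M then 1 else 0) ≤ 1 := fun M ↦ by
    split_ifs <;> omega
  intro o
  induction o with
  | zero => intro m n W _ _ N _ D hO; exact absurd hO (Nat.not_lt_zero _)
  | succ o ihO =>
  intro m
  induction m with
  | zero => intro n W _ _ N _ D _ hm; exact absurd hm (Nat.not_lt_zero _)
  | succ m ihM =>
  intro n
  induction n with
  | zero => intro W _ _ N _ D _ _ hn; exact absurd hn (Nat.not_lt_zero _)
  | succ n ihN =>
    intro W _ _ N _ D hO hmm hnn hopt h9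
    have hN : N = W.conductorNorm ℤ :=
      IsNewformOf.level_eq_conductorNorm_of_exists_isNewformOf hnf D.isNewformOf
    have hN0 : N ≠ 0 := NeZero.ne N
    have h9W : 3 ^ 2 ∣ W.conductorNorm ℤ := hN ▸ h9
    have hbW := hb W
    have hb4N := hb4 N
    -- the lexicographic dispatcher onto the three induction hypotheses
    have IH : ∀ (W' : WeierstrassCurve ℚ) [W'.IsElliptic] [W'.IsGloballyMinimal] (N' : ℕ) [NeZero N']
        (D' : ModularParametrizationData W' N'),
        (2 * ordCompl[2] N' + (if 2 ^ 2 ∣ N' then 1 else 0) <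
            2 * ordCompl[2] N + (if 2 ^ 2 ∣ N then 1 else 0) ∨
          (2 * ordCompl[2] N' + (if 2 ^ 2 ∣ N' then 1 else 0) ≤
              2 * ordCompl[2] N + (if 2 ^ 2 ∣ N then 1 else 0) ∧
            (W'.minimalDiscriminantInt.natAbs < W.minimalDiscriminantInt.natAbs ∨
              (W'.minimalDiscriminantInt.natAbs ≤ W.minimalDiscriminantInt.natAbs ∧
                2 * N' + (if W'.c₆ < 0 then 1 else 0) < 2 * N + (if W.c₆ < 0 then 1 else 0))))) →
        (∀ z ∈ D'.L.lattice, ∃ w ∈ periodLattice D'.f, z = D'.c * w) → 3 ^ 2 ∣ N' →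
        ¬ (3 : ℤ) ∣ D'.maninConstant := by
      intro W' _ _ N' _ D' hlex hopt' h9'
      rcases hlex with hlt | ⟨hle, hlt | ⟨hle', hlt'⟩⟩
      · exact ihO _ _ W' N' D' (by omega) (Nat.lt_succ_self _) (Nat.lt_succ_self _) hopt' h9'
      · exact ihM _ W' N' D' (by omega) (by omega) (Nat.lt_succ_self _) hopt' h9'
      · exact ihN W' N' D' (by omega) (by omega) (by omega) hopt' h9'
    -- the first key along a dyadic untwist to an ADDITIVE-at-`2` partner `A` with `N(A) ∣ 2⁶N`
    have hkeyA : ∀ {A : WeierstrassCurve ℚ} {N' : ℕ}, N' = A.conductorNorm ℤ → A.conductorNorm ℤ ∣ 2 ^ 6 * N →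
        2 ^ 2 ∣ A.conductorNorm ℤ → 2 ^ 2 ∣ N →
        2 * ordCompl[2] N' + (if 2 ^ 2 ∣ N' then 1 else 0) ≤
          2 * ordCompl[2] N + (if 2 ^ 2 ∣ N then 1 else 0) := by
      intro A N' hN' hAN h4A h4
      have hle : ordCompl[2] N' ≤ ordCompl[2] N :=
        maninLocalTwoThree_ordCompl_two_le_of_dvd_pow_mul hN0 (hN' ▸ hAN)
      rw [if_pos (hN' ▸ h4A), if_pos h4]
      omega
    -- (i) a `χ₋₃`-untwist to a class semistable at `3`: closed (twist-covered half)
    by_cases h1 : ∃ (W' : WeierstrassCurve ℚ) (d : ℤ), W'.IsElliptic ∧ W'.IsGloballyMinimal ∧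
        (d = -3) ∧ IsIsogenous W (W'.quadraticTwist (d : ℚ)) ∧ ¬ 3 ^ 2 ∣ W'.conductorNorm ℤ
    · exact maninLocalTwoThree_maninPrimeToThreeAtNine_twistCovered hM hAU hC2 hnf W D hopt h9 h1
    -- (ii) an odd semistable untwist at `q ≠ 3`: transport + the odd part of the level drops
    by_cases h2 : ∃ (W' : WeierstrassCurve ℚ) (q : ℕ), W'.IsElliptic ∧ W'.IsGloballyMinimal ∧
        q.Prime ∧ q ≠ 2 ∧ q ≠ 3 ∧ q ^ 2 ∣ N ∧
        IsIsogenous W (W'.quadraticTwist (((-1 : ℤ) ^ (q / 2) * q : ℤ) : ℚ)) ∧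
        ¬ q ^ 2 ∣ W'.conductorNorm ℤ
    · obtain ⟨W', q, hE', hM', hqp, hq2, hq3, hqN, htw, hqN'⟩ := h2
      haveI := hE'
      haveI := hM'
      haveI : Fact q.Prime := ⟨hqp⟩
      refine maninLocalTwoThree_not_dvd_maninConstant_of_oddUntwist hnf hq2 D hopt hqN htw hqN' ?_
      intro W₁ _ _ N₁ _ D₁ hiso₁ hopt₁
      have hN₁ : N₁ = W'.conductorNorm ℤ := level_eq_conductorNorm_of_isIsogenous hnf D₁ hiso₁
      have hqNW : q ^ 2 ∣ W.conductorNorm ℤ := hN ▸ hqN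
      have hadd : ¬ W.HasGoodReductionAtPrime q ∧ ¬ W.HasMultiplicativeReductionAtPrime q :=
        not_good_and_not_mult_of_sq_dvd_conductorNorm W hqNW
      have hN'N : W'.conductorNorm ℤ ∣ W.conductorNorm ℤ :=
        maninLocalTwoThree_conductorNorm_dvd_of_isIsogenous_twist_pStar hnf hq2 htw hqN' hadd
      have hlt : ordCompl[2] N₁ < ordCompl[2] N := by
        rw [hN₁, hN]
        exact maninLocalTwoThree_ordCompl_two_lt_of_dvd (hN ▸ hN0) hqp hq2 hN'N hqNW hqN'
      have h9₁ : 3 ^ 2 ∣ N₁ :=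
        hN₁ ▸ maninLocalTwoThree_nine_dvd_conductorNorm_of_isIsogenous_twist_pStar hnf hq2 hq3 htw h9W
      have hb₁ := hb4 N₁
      exact IH W₁ N₁ D₁ (Or.inl (by omega)) hopt₁ h9₁
    -- (iii) a dyadic untwist to a class semistable at `2`: transport + the additivity at `2` disappears
    by_cases h3 : ∃ (W' : WeierstrassCurve ℚ) (d : ℤ), W'.IsElliptic ∧ W'.IsGloballyMinimal ∧
        (d = -1 ∨ d = 2 ∨ d = -2) ∧ 2 ^ 2 ∣ N ∧ IsIsogenous W (W'.quadraticTwist (d : ℚ)) ∧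
        ¬ 2 ^ 2 ∣ W'.conductorNorm ℤ
    · obtain ⟨W', d, hE', hM', hd, h4, htw, h4N'⟩ := h3
      haveI := hE'
      haveI := hM'
      haveI : Fact (Nat.Prime 2) := ⟨Nat.prime_two⟩
      refine maninLocalTwoThree_not_dvd_maninConstant_of_dyadicUntwist_semistable hnf D hopt h4 hd htw
        h4N' ?_
      intro W₁ _ _ N₁ _ D₁ hiso₁ hopt₁
      have hN₁ : N₁ = W'.conductorNorm ℤ := level_eq_conductorNorm_of_isIsogenous hnf D₁ hiso₁
      have hadd : ¬ W.HasGoodReductionAtPrime 2 ∧ ¬ W.HasMultiplicativeReductionAtPrime 2 :=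
        not_good_and_not_mult_of_sq_dvd_conductorNorm W (hN ▸ h4)
      have hN'N : W'.conductorNorm ℤ ∣ W.conductorNorm ℤ :=
        (stub_dyadicTwistConductor hnf hd htw h4N' hadd).1
      have hle : ordCompl[2] N₁ ≤ ordCompl[2] N := by
        rw [hN₁, hN]
        exact Nat.le_of_dvd (Nat.ordCompl_pos 2 (hN ▸ hN0)) (Nat.ordCompl_dvd_ordCompl_of_dvd hN'N 2)
      have h4₁ : ¬ 2 ^ 2 ∣ N₁ := hN₁ ▸ h4N'
      have h9₁ : 3 ^ 2 ∣ N₁ :=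
        hN₁ ▸ maninLocalTwoThree_nine_dvd_conductorNorm_of_isIsogenous_dyadicTwist hnf hd htw h9W
      refine IH W₁ N₁ D₁ (Or.inl ?_) hopt₁ h9₁
      rw [if_neg h4₁, if_pos h4]; omega
    -- (iv) a `χ₋₄`-untwist to a lattice-optimal additive-at-`2` curve of lower conductor with `|Δ_min| ≤`
    by_cases h4 : ∃ (A : WeierstrassCurve ℚ) (_ : A.IsElliptic) (_ : A.IsGloballyMinimal) (N' : ℕ)
        (_ : NeZero N') (D' : ModularParametrizationData A N'),
        (∀ z ∈ D'.L.lattice, ∃ w ∈ periodLattice D'.f, z = D'.c * w) ∧ 2 ^ 4 ∣ N ∧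
        2 ^ 2 ∣ A.conductorNorm ℤ ∧ A.conductorNorm ℤ ∣ N ∧ A.conductorNorm ℤ < N ∧
        IsIsogenous W (A.quadraticTwist ((-1 : ℤ) : ℚ)) ∧
        A.minimalDiscriminantInt.natAbs ≤ W.minimalDiscriminantInt.natAbs
    · obtain ⟨A, hAe, hAm, N', hN'0, D', hopt', h16, h4A, hAN, hlt, htw, hΔle⟩ := h4
      have hN' : N' = A.conductorNorm ℤ :=
        IsNewformOf.level_eq_conductorNorm_of_exists_isNewformOf hnf D'.isNewformOf
      have hdvd : D.c ∣ D'.c :=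
        maninLocalTwoThree_maninConstant_dvd_of_additiveTwist_negOne hnf D hopt h16 D' htw h4A hAN
      have h4N : 2 ^ 2 ∣ N := dvd_trans (by norm_num) h16
      have hkey := hkeyA hN' (hAN.trans (dvd_mul_left N _)) h4A h4N
      have h9A : 3 ^ 2 ∣ N' :=
        hN' ▸ maninLocalTwoThree_nine_dvd_conductorNorm_of_isIsogenous_dyadicTwist hnf (Or.inl rfl) htw h9W
      have hbA := hb A
      have hlt' : N' < N := hN' ▸ hlt
      have hD' : ¬ (3 : ℤ) ∣ D'.maninConstant :=
        IH A N' D' (Or.inr ⟨hkey, Or.inr ⟨hΔle, by omega⟩⟩) hopt' h9A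
      exact fun h ↦ hD' (h.trans hdvd)
    -- (v) an aligned `χ±8`-untwist at ANY 2-level with smaller `|Δ_min|` (or lower level and `≤`)
    by_cases h5 : ∃ (A : WeierstrassCurve ℚ) (_ : A.IsElliptic) (_ : A.IsGloballyMinimal) (N' : ℕ)
        (_ : NeZero N') (D' : ModularParametrizationData A N') (d : ℤ) (C : WeierstrassCurve ℚ)
        (u : VariableChange ℚ),
        C.IsElliptic ∧ C.IsGloballyMinimal ∧
        (∀ z ∈ D'.L.lattice, ∃ w ∈ periodLattice D'.f, z = D'.c * w) ∧ (d = 2 ∨ d = -2) ∧ 2 ^ 2 ∣ N ∧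
        2 ^ 2 ∣ A.conductorNorm ℤ ∧ A.conductorNorm ℤ ∣ 2 ^ 6 * N ∧
        IsIsogenous W (A.quadraticTwist (d : ℚ)) ∧ u • A.quadraticTwist (d : ℚ) = C ∧
        C.Δ = (d : ℚ) ^ 6 * A.Δ ∧
        (A.minimalDiscriminantInt.natAbs < W.minimalDiscriminantInt.natAbs ∨
          (A.conductorNorm ℤ < N ∧ A.minimalDiscriminantInt.natAbs ≤ W.minimalDiscriminantInt.natAbs))
    · obtain ⟨A, hAe, hAm, N', hN'0, D', d, C, u, hCe, hCm, hopt', hd, h4, h4A, hAN, htw, hu, hΔ, hlow⟩ := h5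
      haveI := hCe
      haveI := hCm
      have hN' : N' = A.conductorNorm ℤ :=
        IsNewformOf.level_eq_conductorNorm_of_exists_isNewformOf hnf D'.isNewformOf
      refine maninLocalTwoThree_not_dvd_maninConstant_of_additiveUntwist_two_aligned_levelFree hnf D hopt h4
        hd D' htw h4A hAN u hu hΔ ?_
      have hd3 : d = -1 ∨ d = 2 ∨ d = -2 := Or.inr hd
      have h9N' : 3 ^ 2 ∣ N' :=
        hN' ▸ maninLocalTwoThree_nine_dvd_conductorNorm_of_isIsogenous_dyadicTwist hnf hd3 htw h9W
      have hkey := hkeyA hN' hAN h4A h4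
      have hbA := hb A
      rcases hlow with hmA | ⟨hlt, hmA⟩
      · exact IH A N' D' (Or.inr ⟨hkey, Or.inl hmA⟩) hopt' h9N'
      · have hlt' : N' < N := hN' ▸ hlt
        exact IH A N' D' (Or.inr ⟨hkey, Or.inr ⟨hmA, by omega⟩⟩) hopt' h9N'
    -- (vi) an aligned same-level `χ_{q*}`-untwist (odd `q`, `q = 3` allowed), smaller `|Δ_min|`
    by_cases h6 : ∃ (A : WeierstrassCurve ℚ) (_ : A.IsElliptic) (_ : A.IsGloballyMinimal)
        (D' : ModularParametrizationData A N) (q : ℕ) (C : WeierstrassCurve ℚ) (u : VariableChange ℚ),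
        C.IsElliptic ∧ C.IsGloballyMinimal ∧
        (∀ z ∈ D'.L.lattice, ∃ w ∈ periodLattice D'.f, z = D'.c * w) ∧ q.Prime ∧ q ≠ 2 ∧ q ^ 2 ∣ N ∧
        IsIsogenous C W ∧ u • A.quadraticTwist (((-1 : ℤ) ^ (q / 2) * q : ℤ) : ℚ) = C ∧
        C.Δ = ((((-1 : ℤ) ^ (q / 2) * q : ℤ)) : ℚ) ^ 6 * A.Δ ∧
        A.minimalDiscriminantInt.natAbs < W.minimalDiscriminantInt.natAbs
    · obtain ⟨A, hAe, hAm, D', q, C, u, hCe, hCm, hopt', hqp, hq2, hqN, hCW, hu, hΔ, hmA⟩ := h6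
      haveI := hCe
      haveI := hCm
      haveI : Fact q.Prime := ⟨hqp⟩
      have hadd : ¬ W.HasGoodReductionAtPrime q ∧ ¬ W.HasMultiplicativeReductionAtPrime q :=
        not_good_and_not_mult_of_sq_dvd_conductorNorm W (hN ▸ hqN)
      refine maninLocalTwoThree_not_dvd_maninConstant_of_untwist_pStar_aligned hq2 D hopt D' dvd_rfl hqN
        hadd u hu hCW hΔ ?_
      exact IH A N D' (Or.inr ⟨le_rfl, Or.inl hmA⟩) hopt' h9
    -- (vii) the twin normal form: `c₆(W) < 0` and a lattice-optimal same-level `χ₋₄`-twin with `c₆ > 0`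
    by_cases h7 : W.c₆ < 0 ∧ ∃ (A : WeierstrassCurve ℚ) (_ : A.IsElliptic) (_ : A.IsGloballyMinimal)
        (D' : ModularParametrizationData A N),
        (∀ z ∈ D'.L.lattice, ∃ w ∈ periodLattice D'.f, z = D'.c * w) ∧ 2 ^ 4 ∣ N ∧
        2 ^ 2 ∣ A.conductorNorm ℤ ∧ IsIsogenous W (A.quadraticTwist ((-1 : ℤ) : ℚ)) ∧
        A.minimalDiscriminantInt.natAbs ≤ W.minimalDiscriminantInt.natAbs ∧ 0 < A.c₆
    · obtain ⟨hW6, A, hAe, hAm, D', hopt', h16, h4A, htw, hle, hA6⟩ := h7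
      have hN' : N = A.conductorNorm ℤ :=
        IsNewformOf.level_eq_conductorNorm_of_exists_isNewformOf hnf D'.isNewformOf
      have hdvd : D.c ∣ D'.c :=
        maninLocalTwoThree_maninConstant_dvd_of_additiveTwist_negOne hnf D hopt h16 D' htw h4A (hN' ▸ dvd_rfl)
      have hbA0 : (if A.c₆ < 0 then 1 else 0) = 0 := if_neg (not_lt.mpr hA6.le)
      have hbW1 : (if W.c₆ < 0 then 1 else 0) = 1 := if_pos hW6
      have hD' : ¬ (3 : ℤ) ∣ D'.c :=
        IH A N D' (Or.inr ⟨le_rfl, Or.inr ⟨hle, by omega⟩⟩) hopt' h9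
      exact fun h ↦ hD' (h.trans hdvd)
    · exact H hM hAU hC2 hnf W D hopt h9 h1 h2 h3 h4 h5 h6 h7

end Summit.BirchSwinnertonDyer.BirchSwinnertonDyer.Theorems

end
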